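import Mathlib.Analysis.Calculus.ParametricIntegral
import Mathlib.Analysis.Complex.CauchyIntegral
import Mathlib.Analysis.SpecialFunctions.ImproperIntegrals
import Mathlib.Analysis.Calculus.ContDiff.Bounds
import Literature.Analysis.InverseSpectral.StieltjesInversion
import HarnessLib

/-!
# The Schwarz integral of a bounded function on the line

Topic `Literature/Analysis/Fourier`. For a bounded measurable `h : ℝ → ℝ` the **Schwarz integral**

  `𝒮h(z) = (πi)⁻¹ ∫ h(t) (1/(t - z) - t/(1 + t²)) dt`   (`Im z > 0`)

is holomorphic on the upper half-plane, with real part the Poisson integral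
`P_y[h](x) = π⁻¹ ∫ h(t) y/((x-t)² + y²) dt` and imaginary part the (modified) conjugate Poisson
integral `Q_y[h](x) = π⁻¹ ∫ h(t) ((x-t)/((x-t)² + y²) + t/(1+t²)) dt` (the modification `t/(1+t²)`
makes the kernel `O(t⁻²)`, so bounded `h` are allowed; Koosis, *Introduction to `Hᵖ` spaces*,
Ch. I; Garnett, *Bounded analytic functions*, Ch. III §1). We prove:

* `differentiableAt_schwarzIntegral`, `schwarzIntegral_eq` — holomorphy and `𝒮h = P + iQ`;
* `tendsto_poissonIntegral_of_continuousAt`, `poissonIntegral_le`, `le_poissonIntegral` — the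
  Poisson integral is an approximate identity at continuity points and respects bounds;
* `tendsto_conjPoissonIntegral`, `hasDerivAt_hilbertC2` — for `h ∈ C²` with compact support,
  `Q_y[h](x) → ℋh(x)` as `y ↓ 0`, where
  `ℋh(x) = π⁻¹ (∫_{|u|<1} (h(x-u) - h(x))/u du + ∫_{|u|≥1} h(x-u)/u du + ∫ h(t) t/(1+t²) dt)`
  is the (modified) Hilbert transform, and `ℋh` is differentiable with the expected derivative.

These are the inputs of the explicit multiplier construction for the Bourgain–Dyatlov fractal
uncertainty principle following Jin–Zhang, arXiv:1710.00250, §§2.3–3. All statements are folklore;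
no definitions are introduced (the kernels are written out).
-/

namespace Literature.Analysis.Fourier

open _root_.MeasureTheory Set Filter _root_.Complex Metric
open scoped Real Topology

/-! ### The kernels -/

section Kernels

/-- Pointwise bound for the modified conjugate Poisson kernel:
`|(x-t)/((x-t)²+y²) + t/(1+t²)| ≤ (x² + y² + 2|x| + 1)/((x-t)² + y²)`. [folklore] -/
theorem abs_conjPoissonKernel_le (x t : ℝ) {y : ℝ} (hy : 0 < y) :
    |(x - t) / ((x - t) ^ 2 + y ^ 2) + t / (1 + t ^ 2)| ≤
      (x ^ 2 + y ^ 2 + 2 * |x| + 1) / ((x - t) ^ 2 + y ^ 2) := by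
  have hD : 0 < (x - t) ^ 2 + y ^ 2 := by positivity
  have hT : 0 < 1 + t ^ 2 := by positivity
  have heq : (x - t) / ((x - t) ^ 2 + y ^ 2) + t / (1 + t ^ 2) =
      (x * (1 - t ^ 2) + t * (x ^ 2 + y ^ 2 - 1)) / (((x - t) ^ 2 + y ^ 2) * (1 + t ^ 2)) := by
    field_simp
    ring
  rw [heq, abs_div, abs_of_pos (mul_pos hD hT), div_le_div_iff₀ (mul_pos hD hT) hD]
  have h1 : |x * (1 - t ^ 2) + t * (x ^ 2 + y ^ 2 - 1)| ≤ (|x| + (x ^ 2 + y ^ 2 + 1)) * (1 + t ^ 2) := by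
    have ht : |t| ≤ 1 + t ^ 2 := by
      cases le_or_gt 0 t with
      | inl h => rw [abs_of_nonneg h]; nlinarith [sq_nonneg (t - 1)]
      | inr h => rw [abs_of_neg h]; nlinarith [sq_nonneg (t + 1)]
    calc |x * (1 - t ^ 2) + t * (x ^ 2 + y ^ 2 - 1)|
        ≤ |x * (1 - t ^ 2)| + |t * (x ^ 2 + y ^ 2 - 1)| := abs_add_le _ _
      _ = |x| * |1 - t ^ 2| + |t| * |x ^ 2 + y ^ 2 - 1| := by rw [abs_mul, abs_mul]
      _ ≤ |x| * (1 + t ^ 2) + (1 + t ^ 2) * (x ^ 2 + y ^ 2 + 1) := by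
          gcongr
          · exact abs_le.2 ⟨by nlinarith [sq_nonneg t], by nlinarith [sq_nonneg t]⟩
          · exact abs_le.2 ⟨by nlinarith [sq_nonneg x, sq_nonneg y], by nlinarith [sq_nonneg x]⟩
      _ = (|x| + (x ^ 2 + y ^ 2 + 1)) * (1 + t ^ 2) := by ring
  calc |x * (1 - t ^ 2) + t * (x ^ 2 + y ^ 2 - 1)| * ((x - t) ^ 2 + y ^ 2)
      ≤ (|x| + (x ^ 2 + y ^ 2 + 1)) * (1 + t ^ 2) * ((x - t) ^ 2 + y ^ 2) :=
        mul_le_mul_of_nonneg_right h1 hD.le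
    _ ≤ (x ^ 2 + y ^ 2 + 2 * |x| + 1) * (((x - t) ^ 2 + y ^ 2) * (1 + t ^ 2)) := by
        have : |x| + (x ^ 2 + y ^ 2 + 1) ≤ x ^ 2 + y ^ 2 + 2 * |x| + 1 := by
          linarith [abs_nonneg x]
        nlinarith [mul_pos hD hT]

/-- The Poisson kernel is continuous in `t`. [folklore] -/
theorem continuous_poissonKernel' (x : ℝ) {y : ℝ} (hy : 0 < y) :
    Continuous fun t : ℝ => y / ((x - t) ^ 2 + y ^ 2) := by
  refine continuous_const.div (by fun_prop) fun t => ?_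
  positivity

/-- The modified conjugate Poisson kernel is continuous in `t`. [folklore] -/
theorem continuous_conjPoissonKernel (x : ℝ) {y : ℝ} (hy : 0 < y) :
    Continuous fun t : ℝ => (x - t) / ((x - t) ^ 2 + y ^ 2) + t / (1 + t ^ 2) := by
  refine (Continuous.div (by fun_prop) (by fun_prop) fun t => ?_).add
    (Continuous.div (by fun_prop) (by fun_prop) fun t => ?_) <;> positivity

/-- `h · P_y(x - ·)` is integrable for bounded measurable `h`. [folklore] -/
theorem integrable_mul_poissonKernel {h : ℝ → ℝ} (hm : AEStronglyMeasurable h volume) {B : ℝ}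
    (hB : ∀ t, |h t| ≤ B) (x : ℝ) {y : ℝ} (hy : 0 < y) :
    Integrable fun t : ℝ => h t * (y / ((x - t) ^ 2 + y ^ 2)) := by
  have hP := Literature.Analysis.InverseSpectral.integrable_poissonKernel hy x
  refine Integrable.mono' (hP.const_mul B) (hm.mul (continuous_poissonKernel' x hy).aestronglyMeasurable)
    (Eventually.of_forall fun t => ?_)
  rw [norm_mul, Real.norm_eq_abs, Real.norm_eq_abs,
    abs_of_nonneg (by positivity : (0 : ℝ) ≤ y / ((x - t) ^ 2 + y ^ 2))]
  exact mul_le_mul_of_nonneg_right (hB t) (by positivity)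

/-- `h · Q_y(x, ·)` is integrable for bounded measurable `h`. [folklore] -/
theorem integrable_mul_conjPoissonKernel {h : ℝ → ℝ} (hm : AEStronglyMeasurable h volume) {B : ℝ}
    (hB : ∀ t, |h t| ≤ B) (x : ℝ) {y : ℝ} (hy : 0 < y) :
    Integrable fun t : ℝ => h t * ((x - t) / ((x - t) ^ 2 + y ^ 2) + t / (1 + t ^ 2)) := by
  have hB0 : 0 ≤ B := (abs_nonneg _).trans (hB 0)
  have hP := Literature.Analysis.InverseSpectral.integrable_poissonKernel hy x
  set M : ℝ := x ^ 2 + y ^ 2 + 2 * |x| + 1 with hM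
  have hMy : ∀ t, (x ^ 2 + y ^ 2 + 2 * |x| + 1) / ((x - t) ^ 2 + y ^ 2) =
      (M / y) * (y / ((x - t) ^ 2 + y ^ 2)) := by
    intro t
    have : (x - t) ^ 2 + y ^ 2 ≠ 0 := by positivity
    rw [hM]; field_simp
  refine Integrable.mono' ((hP.const_mul (M / y)).const_mul B)
    (hm.mul (continuous_conjPoissonKernel x hy).aestronglyMeasurable)
    (Eventually.of_forall fun t => ?_)
  rw [norm_mul, Real.norm_eq_abs, Real.norm_eq_abs]
  calc |h t| * |(x - t) / ((x - t) ^ 2 + y ^ 2) + t / (1 + t ^ 2)|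
      ≤ B * ((x ^ 2 + y ^ 2 + 2 * |x| + 1) / ((x - t) ^ 2 + y ^ 2)) :=
        mul_le_mul (hB t) (abs_conjPoissonKernel_le x t hy) (abs_nonneg _) hB0
    _ = B * ((M / y) * (y / ((x - t) ^ 2 + y ^ 2))) := by rw [hMy]

end Kernels

/-! ### The Schwarz integral: holomorphy and real/imaginary parts -/

section Schwarz

/-- The Schwarz kernel split into Poisson and conjugate Poisson kernels:
`(πi)⁻¹ (1/(t-z) - t/(1+t²)) = π⁻¹ P + i π⁻¹ Q` at `z = x + iy`. [folklore] -/
theorem schwarzKernel_eq (t x : ℝ) {y : ℝ} (hy : 0 < y) :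
    ((π : ℂ) * I)⁻¹ * (1 / ((t : ℂ) - (x + y * I)) - t / (1 + (t : ℂ) ^ 2)) =
      ((π⁻¹ * (y / ((x - t) ^ 2 + y ^ 2)) : ℝ) : ℂ) +
        ((π⁻¹ * ((x - t) / ((x - t) ^ 2 + y ^ 2) + t / (1 + t ^ 2)) : ℝ) : ℂ) * I := by
  have hD : (x - t) ^ 2 + y ^ 2 ≠ 0 := by positivity
  have hT : (1 : ℝ) + t ^ 2 ≠ 0 := by positivity
  have hπ : (π : ℂ) ≠ 0 := ofReal_ne_zero.2 Real.pi_pos.ne'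
  have hw : (t : ℂ) - (x + y * I) ≠ 0 := by
    intro h
    have := congrArg Complex.im h
    simp at this
    exact hy.ne' (by linarith)
  have hTc : (1 : ℂ) + (t : ℂ) ^ 2 ≠ 0 := by exact_mod_cast hT
  have hDc : ((x : ℂ) - t) ^ 2 + (y : ℂ) ^ 2 ≠ 0 := by exact_mod_cast hD
  -- clear denominators on the right
  have h1 : (1 : ℂ) / ((t : ℂ) - (x + y * I)) = ((x : ℂ) - t - y * I) * (-1) / (((x : ℂ) - t) ^ 2 + (y : ℂ) ^ 2) := by
    rw [div_eq_div_iff hw hDc]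
    ring_nf
    rw [I_sq]
    ring
  rw [h1]
  push_cast
  field_simp
  ring_nf
  rw [I_sq]
  ring

/-- The Schwarz integrand of a bounded measurable `h` is integrable for `Im z > 0`. [folklore] -/
theorem integrable_schwarzIntegrand {h : ℝ → ℝ} (hm : AEStronglyMeasurable h volume) {B : ℝ}
    (hB : ∀ t, |h t| ≤ B) {z : ℂ} (hz : 0 < z.im) :
    Integrable fun t : ℝ => (h t : ℂ) * (1 / ((t : ℂ) - z) - t / (1 + (t : ℂ) ^ 2)) := by
  -- multiply by the unit `(π i)⁻¹` and use the real decomposition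
  have hz' : z = (z.re : ℂ) + (z.im : ℂ) * I := (re_add_im z).symm
  have key : ∀ t : ℝ, (h t : ℂ) * (1 / ((t : ℂ) - z) - t / (1 + (t : ℂ) ^ 2)) =
      ((π : ℂ) * I * (π⁻¹ : ℝ)) * (((h t * (z.im / ((z.re - t) ^ 2 + z.im ^ 2)) : ℝ) : ℂ) +
        ((h t * ((z.re - t) / ((z.re - t) ^ 2 + z.im ^ 2) + t / (1 + t ^ 2)) : ℝ) : ℂ) * I) := by
    intro t
    have h1 := schwarzKernel_eq t z.re hz
    rw [← hz'] at h1
    have hπI : (π : ℂ) * I ≠ 0 := mul_ne_zero (ofReal_ne_zero.2 Real.pi_pos.ne') I_ne_zero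
    calc (h t : ℂ) * (1 / ((t : ℂ) - z) - t / (1 + (t : ℂ) ^ 2))
        = (h t : ℂ) * (((π : ℂ) * I) * (((π : ℂ) * I)⁻¹ * (1 / ((t : ℂ) - z) - t / (1 + (t : ℂ) ^ 2)))) := by
          rw [← mul_assoc ((π : ℂ) * I), mul_inv_cancel₀ hπI, one_mul]
      _ = _ := by rw [h1]; push_cast; ring
  simp_rw [key]
  refine Integrable.const_mul ?_ _
  refine Integrable.add ?_ ?_
  · exact (integrable_mul_poissonKernel hm hB z.re hz).ofReal (𝕜 := ℂ)
  · exact ((integrable_mul_conjPoissonKernel hm hB z.re hz).ofReal (𝕜 := ℂ)).mul_const _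

/-- **Real and imaginary parts of the Schwarz integral**: at `z = x + iy`, `y > 0`,
`𝒮h(z) = P_y[h](x) + i Q_y[h](x)`. [folklore] -/
theorem schwarzIntegral_eq {h : ℝ → ℝ} (hm : AEStronglyMeasurable h volume) {B : ℝ}
    (hB : ∀ t, |h t| ≤ B) (x : ℝ) {y : ℝ} (hy : 0 < y) :
    ((π : ℂ) * I)⁻¹ * ∫ t : ℝ, (h t : ℂ) * (1 / ((t : ℂ) - (x + y * I)) - t / (1 + (t : ℂ) ^ 2)) =
      ((π⁻¹ * ∫ t : ℝ, h t * (y / ((x - t) ^ 2 + y ^ 2)) : ℝ) : ℂ) +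
        ((π⁻¹ * ∫ t : ℝ, h t * ((x - t) / ((x - t) ^ 2 + y ^ 2) + t / (1 + t ^ 2)) : ℝ) : ℂ) * I := by
  have key : ∀ t : ℝ, ((π : ℂ) * I)⁻¹ * ((h t : ℂ) * (1 / ((t : ℂ) - (x + y * I)) - t / (1 + (t : ℂ) ^ 2))) =
      ((π⁻¹ : ℝ) : ℂ) * ((((h t * (y / ((x - t) ^ 2 + y ^ 2))) : ℝ) : ℂ) +
        ((h t * ((x - t) / ((x - t) ^ 2 + y ^ 2) + t / (1 + t ^ 2)) : ℝ) : ℂ) * I) := by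
    intro t
    rw [mul_left_comm, schwarzKernel_eq t x hy]
    push_cast
    ring
  rw [← integral_const_mul]
  simp_rw [key]
  have i1 := (integrable_mul_poissonKernel hm hB x hy).ofReal (𝕜 := ℂ)
  have i2 := ((integrable_mul_conjPoissonKernel hm hB x hy).ofReal (𝕜 := ℂ)).mul_const I
  have hsum : (∫ a : ℝ, (((h a * (y / ((x - a) ^ 2 + y ^ 2)) : ℝ) : ℂ) +
      ((h a * ((x - a) / ((x - a) ^ 2 + y ^ 2) + a / (1 + a ^ 2)) : ℝ) : ℂ) * I)) =
      (∫ a : ℝ, (((h a * (y / ((x - a) ^ 2 + y ^ 2)) : ℝ) : ℂ))) +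
        ∫ a : ℝ, ((h a * ((x - a) / ((x - a) ^ 2 + y ^ 2) + a / (1 + a ^ 2)) : ℝ) : ℂ) * I :=
    integral_add i1 i2
  rw [integral_const_mul, hsum, integral_mul_const, integral_complex_ofReal, integral_complex_ofReal]
  push_cast
  ring

/-- **The Schwarz integral of a bounded measurable function is holomorphic on the upper
half-plane.** [folklore] -/
theorem differentiableAt_schwarzIntegral {h : ℝ → ℝ} (hm : AEStronglyMeasurable h volume) {B : ℝ}
    (hB : ∀ t, |h t| ≤ B) {z₀ : ℂ} (hz₀ : 0 < z₀.im) :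
    DifferentiableAt ℂ
      (fun z : ℂ => ((π : ℂ) * I)⁻¹ * ∫ t : ℝ, (h t : ℂ) * (1 / ((t : ℂ) - z) - t / (1 + (t : ℂ) ^ 2))) z₀ := by
  refine DifferentiableAt.const_mul ?_ _
  have hB0 : 0 ≤ B := (abs_nonneg _).trans (hB 0)
  set x₀ : ℝ := z₀.re
  set y₀ : ℝ := z₀.im
  set F : ℂ → ℝ → ℂ := fun z t => (h t : ℂ) * (1 / ((t : ℂ) - z) - t / (1 + (t : ℂ) ^ 2)) with hF
  set F' : ℂ → ℝ → ℂ := fun z t => (h t : ℂ) * (1 / ((t : ℂ) - z) ^ 2) with hF'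
  set bound : ℝ → ℝ := fun t => B * (6 / y₀ * (y₀ / ((x₀ - t) ^ 2 + y₀ ^ 2))) with hbound
  have hr : 0 < y₀ / 2 := by positivity
  -- points of the ball stay in the upper half-plane, quantitatively
  have hball : ∀ z ∈ ball z₀ (y₀ / 2), y₀ / 2 < z.im ∧ |z.re - x₀| < y₀ / 2 := by
    intro z hz
    rw [mem_ball, dist_eq_norm] at hz
    have h1 : |(z - z₀).im| ≤ ‖z - z₀‖ := abs_im_le_norm _
    have h2 : |(z - z₀).re| ≤ ‖z - z₀‖ := abs_re_le_norm _
    simp only [sub_im, sub_re] at h1 h2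
    constructor
    · have := (abs_lt.1 (h1.trans_lt hz)).1
      change y₀ / 2 < z.im
      linarith
    · exact h2.trans_lt hz
  have hne : ∀ z : ℂ, 0 < z.im → ∀ t : ℝ, (t : ℂ) - z ≠ 0 := by
    intro z hz t h
    have := congrArg Complex.im h
    simp at this
    linarith
  have hmeasF : ∀ z : ℂ, 0 < z.im → AEStronglyMeasurable (F z) volume := by
    intro z hz
    refine (Complex.continuous_ofReal.comp_aestronglyMeasurable hm).mul ?_
    refine (Continuous.aestronglyMeasurable ?_)
    refine (continuous_const.div (by fun_prop) (hne z hz)).sub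
      (Continuous.div (by fun_prop) (by fun_prop) fun t => ?_)
    exact_mod_cast (by positivity : (1 : ℝ) + t ^ 2 ≠ 0)
  have key := hasDerivAt_integral_of_dominated_loc_of_deriv_le (μ := volume) (x₀ := z₀)
    (F := F) (F' := F') (bound := bound) (ball_mem_nhds z₀ hr) ?_ ?_ ?_ ?_ ?_ ?_
  · exact key.2.differentiableAt
  · filter_upwards [ball_mem_nhds z₀ hr] with z hz
    exact hmeasF z (hr.trans (hball z hz).1)
  · exact integrable_schwarzIntegrand hm hB hz₀
  · refine (Complex.continuous_ofReal.comp_aestronglyMeasurable hm).mul ?_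
    refine Continuous.aestronglyMeasurable ?_
    exact continuous_const.div (by fun_prop) fun t => pow_ne_zero _ (hne z₀ hz₀ t)
  · -- domination of `F'` on the ball
    refine Eventually.of_forall fun t z hz => ?_
    obtain ⟨hzim, hzre⟩ := hball z hz
    have hzpos : 0 < z.im := hr.trans hzim
    rw [hF', hbound]
    simp only
    rw [norm_mul, Complex.norm_real, Real.norm_eq_abs, norm_div, norm_one, norm_pow]
    have hnorm : ‖(t : ℂ) - z‖ ^ 2 = (t - z.re) ^ 2 + z.im ^ 2 := by
      rw [Complex.sq_norm, Complex.normSq_apply]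
      simp; ring
    rw [hnorm]
    have hD0 : 0 < (x₀ - t) ^ 2 + y₀ ^ 2 := by positivity
    have hcomp : (x₀ - t) ^ 2 + y₀ ^ 2 ≤ 6 * ((t - z.re) ^ 2 + z.im ^ 2) := by
      have h1 : (x₀ - t) ^ 2 ≤ 2 * (t - z.re) ^ 2 + 2 * (z.re - x₀) ^ 2 := by
        nlinarith [sq_nonneg ((t - z.re) - (z.re - x₀))]
      have h2 : (z.re - x₀) ^ 2 < (y₀ / 2) ^ 2 := by
        have := abs_lt.1 hzre
        nlinarith
      have h3 : (y₀ / 2) ^ 2 < z.im ^ 2 := by nlinarith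
      nlinarith
    have hy0' : y₀ ≠ 0 := hz₀.ne'
    calc |h t| * (1 / ((t - z.re) ^ 2 + z.im ^ 2))
        ≤ B * (6 / ((x₀ - t) ^ 2 + y₀ ^ 2)) := by
          refine mul_le_mul (hB t) ?_ (by positivity) hB0
          rw [div_le_div_iff₀ (by positivity) hD0]
          linarith
      _ = B * (6 / y₀ * (y₀ / ((x₀ - t) ^ 2 + y₀ ^ 2))) := by
          congr 1
          field_simp
  · exact ((Literature.Analysis.InverseSpectral.integrable_poissonKernel hz₀ x₀).const_mul _).const_mul _
  · -- pointwise derivative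
    refine Eventually.of_forall fun t z hz => ?_
    have hzpos : 0 < z.im := hr.trans (hball z hz).1
    have h1 : HasDerivAt (fun w : ℂ => (t : ℂ) - w) (-1) z := by
      simpa using (hasDerivAt_id z).const_sub (t : ℂ)
    have h2 := (h1.inv (hne z hzpos t)).sub_const ((t : ℂ) / (1 + (t : ℂ) ^ 2))
    have h3 : HasDerivAt (fun w : ℂ => 1 / ((t : ℂ) - w) - t / (1 + (t : ℂ) ^ 2))
        (1 / ((t : ℂ) - z) ^ 2) z := by
      simp only [one_div, neg_neg, Pi.inv_apply] at h2 ⊢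
      exact h2
    simp only [hF, hF']
    exact h3.const_mul _

end Schwarz

/-! ### The Poisson integral: bounds and approximate identity -/

section Poisson

/-- Upper bound: `h ≤ M` implies `P_y[h] ≤ M`. [folklore] -/
theorem poissonIntegral_le {h : ℝ → ℝ} (hm : AEStronglyMeasurable h volume) {B : ℝ}
    (hB : ∀ t, |h t| ≤ B) {M : ℝ} (hM : ∀ t, h t ≤ M) (x : ℝ) {y : ℝ} (hy : 0 < y) :
    π⁻¹ * ∫ t : ℝ, h t * (y / ((x - t) ^ 2 + y ^ 2)) ≤ M := by
  have hP := Literature.Analysis.InverseSpectral.integrable_poissonKernel hy x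
  have h1 : ∫ t : ℝ, h t * (y / ((x - t) ^ 2 + y ^ 2)) ≤ ∫ t : ℝ, M * (y / ((x - t) ^ 2 + y ^ 2)) :=
    integral_mono (integrable_mul_poissonKernel hm hB x hy) (hP.const_mul M) fun t =>
      mul_le_mul_of_nonneg_right (hM t) (by positivity)
  rw [integral_const_mul, Literature.Analysis.InverseSpectral.integral_poissonKernel hy x] at h1
  calc π⁻¹ * ∫ t : ℝ, h t * (y / ((x - t) ^ 2 + y ^ 2)) ≤ π⁻¹ * (M * π) :=
        mul_le_mul_of_nonneg_left h1 (by positivity)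
    _ = M := by field_simp

/-- Lower bound: `m ≤ h` implies `m ≤ P_y[h]`. [folklore] -/
theorem le_poissonIntegral {h : ℝ → ℝ} (hm : AEStronglyMeasurable h volume) {B : ℝ}
    (hB : ∀ t, |h t| ≤ B) {m : ℝ} (hM : ∀ t, m ≤ h t) (x : ℝ) {y : ℝ} (hy : 0 < y) :
    m ≤ π⁻¹ * ∫ t : ℝ, h t * (y / ((x - t) ^ 2 + y ^ 2)) := by
  have hP := Literature.Analysis.InverseSpectral.integrable_poissonKernel hy x
  have h1 : ∫ t : ℝ, m * (y / ((x - t) ^ 2 + y ^ 2)) ≤ ∫ t : ℝ, h t * (y / ((x - t) ^ 2 + y ^ 2)) :=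
    integral_mono (hP.const_mul m) (integrable_mul_poissonKernel hm hB x hy) fun t =>
      mul_le_mul_of_nonneg_right (hM t) (by positivity)
  rw [integral_const_mul, Literature.Analysis.InverseSpectral.integral_poissonKernel hy x] at h1
  calc m = π⁻¹ * (m * π) := by field_simp
    _ ≤ π⁻¹ * ∫ t : ℝ, h t * (y / ((x - t) ^ 2 + y ^ 2)) := mul_le_mul_of_nonneg_left h1 (by positivity)

/-- `|P_y[h]| ≤ B` if `|h| ≤ B`. [folklore] -/
theorem abs_poissonIntegral_le {h : ℝ → ℝ} (hm : AEStronglyMeasurable h volume) {B : ℝ}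
    (hB : ∀ t, |h t| ≤ B) (x : ℝ) {y : ℝ} (hy : 0 < y) :
    |π⁻¹ * ∫ t : ℝ, h t * (y / ((x - t) ^ 2 + y ^ 2))| ≤ B :=
  abs_le.2 ⟨le_poissonIntegral hm hB (fun t => (abs_le.1 (hB t)).1) x hy,
    poissonIntegral_le hm hB (fun t => (abs_le.1 (hB t)).2) x hy⟩

/-- **The Poisson integral is an approximate identity at continuity points**: for bounded
measurable `h` continuous at `x`, `P_y[h](x) → h(x)` as `y ↓ 0`. [folklore] -/
theorem tendsto_poissonIntegral_of_continuousAt {h : ℝ → ℝ} (hm : AEStronglyMeasurable h volume)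
    {B : ℝ} (hB : ∀ t, |h t| ≤ B) {x : ℝ} (hx : ContinuousAt h x) :
    Tendsto (fun y : ℝ => π⁻¹ * ∫ t : ℝ, h t * (y / ((x - t) ^ 2 + y ^ 2))) (𝓝[>] 0) (𝓝 (h x)) := by
  have hB0 : 0 ≤ B := (abs_nonneg _).trans (hB 0)
  have hpi := Real.pi_pos
  rw [Metric.tendsto_nhdsWithin_nhds]
  intro ε hε
  obtain ⟨δ, hδ, hδh⟩ := Metric.continuousAt_iff.1 hx (ε / 2) (by positivity)
  refine ⟨ε * δ / (8 * (B + 1)), by positivity, fun {y} hy hyd => ?_⟩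
  have hy0 : 0 < y := hy
  rw [Real.dist_eq, sub_zero, abs_of_pos hy0] at hyd
  set P : ℝ → ℝ := fun t => y / ((x - t) ^ 2 + y ^ 2) with hP
  have hPint : Integrable P := Literature.Analysis.InverseSpectral.integrable_poissonKernel hy0 x
  have hPpos : ∀ t, 0 ≤ P t := fun t => by positivity
  have hPc : Continuous P := continuous_poissonKernel' x hy0
  have hbd2 : ∀ t, ‖h t - h x‖ ≤ 2 * B := fun t => by
    calc ‖h t - h x‖ ≤ ‖h t‖ + ‖h x‖ := norm_sub_le _ _
      _ ≤ B + B := add_le_add (hB t) (hB x)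
      _ = 2 * B := by ring
  have hEint : Integrable (fun t => (h t - h x) * P t) := by
    refine (hPint.const_mul (2 * B)).mono' ((hm.sub aestronglyMeasurable_const).mul hPc.aestronglyMeasurable)
      (ae_of_all _ fun t => ?_)
    rw [norm_mul, Real.norm_eq_abs (P t), abs_of_nonneg (hPpos t)]
    exact mul_le_mul_of_nonneg_right (hbd2 t) (hPpos t)
  -- `P_y[h](x) - h(x) = π⁻¹ ∫ (h - h x) P`
  have hdiff : π⁻¹ * (∫ t, h t * P t) - h x = π⁻¹ * ∫ t, (h t - h x) * P t := by
    have h1 : ∫ t, (h t - h x) * P t = (∫ t, h t * P t) - ∫ t, h x * P t := by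
      rw [← integral_sub (integrable_mul_poissonKernel hm hB x hy0) (hPint.const_mul _)]
      exact integral_congr_ae (ae_of_all _ fun t => by ring)
    rw [h1, integral_const_mul, Literature.Analysis.InverseSpectral.integral_poissonKernel hy0 x]
    field_simp
  -- near part
  have hnear : ‖∫ t in ball x δ, (h t - h x) * P t‖ ≤ ε / 2 * π := by
    calc ‖∫ t in ball x δ, (h t - h x) * P t‖
        ≤ ∫ t in ball x δ, ‖(h t - h x) * P t‖ := norm_integral_le_integral_norm _
      _ ≤ ∫ t in ball x δ, (ε / 2) * P t := by
          refine setIntegral_mono_on hEint.norm.integrableOn (hPint.const_mul _).integrableOn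
            measurableSet_ball (fun t ht => ?_)
          rw [norm_mul, Real.norm_eq_abs (P t), abs_of_nonneg (hPpos t)]
          refine mul_le_mul_of_nonneg_right (le_of_lt ?_) (hPpos t)
          have := hδh (mem_ball.1 ht)
          rwa [Real.dist_eq] at this
      _ ≤ ∫ t, (ε / 2) * P t :=
          setIntegral_le_integral (hPint.const_mul _) (ae_of_all _ fun t => by
            have := hPpos t; positivity)
      _ = ε / 2 * π := by
          rw [integral_const_mul, Literature.Analysis.InverseSpectral.integral_poissonKernel hy0 x]
  -- far part
  have hcompl : (ball x δ)ᶜ = {t : ℝ | δ ≤ |t - x|} := by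
    ext t
    simp [mem_ball, Real.dist_eq, not_lt]
  obtain ⟨htint, htval⟩ := Literature.Analysis.InverseSpectral.integral_tail_div_sq_shift hδ y x
  have hfar : ‖∫ t in (ball x δ)ᶜ, (h t - h x) * P t‖ ≤ 2 * B * (2 * y / δ) := by
    rw [hcompl]
    calc ‖∫ t in {t : ℝ | δ ≤ |t - x|}, (h t - h x) * P t‖
        ≤ ∫ t in {t : ℝ | δ ≤ |t - x|}, ‖(h t - h x) * P t‖ := norm_integral_le_integral_norm _
      _ ≤ ∫ t in {t : ℝ | δ ≤ |t - x|}, (2 * B) * (y / (x - t) ^ 2) := by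
          refine setIntegral_mono_on hEint.norm.integrableOn (htint.const_mul _)
            (measurableSet_le measurable_const
              (continuous_abs.comp (continuous_sub_right x)).measurable)
            (fun t ht => ?_)
          simp only [mem_setOf_eq] at ht
          have ht0 : 0 < (x - t) ^ 2 := by
            have : x - t ≠ 0 := by
              intro h0; rw [show t = x by linarith, sub_self, abs_zero] at ht; linarith
            positivity
          rw [norm_mul, Real.norm_eq_abs (P t), abs_of_nonneg (hPpos t)]
          refine mul_le_mul (hbd2 t) ?_ (hPpos t) (by positivity)
          exact div_le_div_of_nonneg_left hy0.le ht0 (by nlinarith)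
      _ = 2 * B * (2 * y / δ) := by rw [integral_const_mul, htval]
  -- conclusion
  rw [Real.dist_eq, hdiff, ← integral_add_compl measurableSet_ball hEint, abs_mul,
    abs_of_pos (inv_pos.2 hpi), ← Real.norm_eq_abs]
  calc π⁻¹ * ‖(∫ t in ball x δ, (h t - h x) * P t) + ∫ t in (ball x δ)ᶜ, (h t - h x) * P t‖
      ≤ π⁻¹ * (‖∫ t in ball x δ, (h t - h x) * P t‖ + ‖∫ t in (ball x δ)ᶜ, (h t - h x) * P t‖) :=
        mul_le_mul_of_nonneg_left (norm_add_le _ _) (by positivity)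
    _ ≤ π⁻¹ * (ε / 2 * π + 2 * B * (2 * y / δ)) := by gcongr
    _ = ε / 2 + π⁻¹ * (4 * B * y / δ) := by field_simp; ring
    _ < ε := by
        have h1 : 4 * B * y / δ ≤ 4 * (B + 1) * y / δ := by gcongr; linarith
        have h2 : 4 * (B + 1) * y / δ < ε / 2 := by
          rw [div_lt_iff₀ hδ]
          have := mul_lt_mul_of_pos_left hyd (by positivity : (0 : ℝ) < 4 * (B + 1))
          calc 4 * (B + 1) * y < 4 * (B + 1) * (ε * δ / (8 * (B + 1))) := this
            _ = ε / 2 * δ := by field_simp; ring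
        have h3 : π⁻¹ * (4 * B * y / δ) ≤ 4 * B * y / δ := by
          have h4 : 0 ≤ 4 * B * y / δ := by positivity
          have h5 : π⁻¹ ≤ 1 := by
            rw [inv_le_one_iff₀]; right; linarith [Real.pi_gt_three]
          exact mul_le_of_le_one_left h4 h5
        linarith

/-- The same limit along a sequence `y_n → 0⁺`. [folklore] -/
theorem tendsto_poissonIntegral_seq {h : ℝ → ℝ} (hm : AEStronglyMeasurable h volume)
    {B : ℝ} (hB : ∀ t, |h t| ≤ B) {x : ℝ} (hx : ContinuousAt h x) {ys : ℕ → ℝ}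
    (hpos : ∀ n, 0 < ys n) (hlim : Tendsto ys atTop (𝓝 0)) :
    Tendsto (fun n => π⁻¹ * ∫ t : ℝ, h t * (ys n / ((x - t) ^ 2 + (ys n) ^ 2))) atTop (𝓝 (h x)) := by
  have h1 := tendsto_poissonIntegral_of_continuousAt hm hB hx
  have h2 : Tendsto ys atTop (𝓝[>] 0) :=
    tendsto_nhdsWithin_iff.2 ⟨hlim, Eventually.of_forall fun n => hpos n⟩
  exact h1.comp h2

end Poisson

/-! ### The conjugate Poisson integral of a `C²` function with compact support -/

section Hilbert

variable {h : ℝ → ℝ}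

/-- Bounds for a `C²` function with compact support: `|h| ≤ B`, `|h'| ≤ L`, `h` is `L`-Lipschitz and
`h'` is `L₂`-Lipschitz, and `h`, `h'` vanish off `[-R, R]`. [folklore] -/
theorem exists_bounds_of_contDiff_two (hh : ContDiff ℝ 2 h) (hsupp : HasCompactSupport h) :
    ∃ B L L₂ R : ℝ, 0 ≤ B ∧ 0 ≤ L ∧ 0 ≤ L₂ ∧ 0 ≤ R ∧ (∀ t, |h t| ≤ B) ∧ (∀ t, |deriv h t| ≤ L) ∧
      (∀ a b, |h a - h b| ≤ L * |a - b|) ∧ (∀ a b, |deriv h a - deriv h b| ≤ L₂ * |a - b|) ∧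
      (∀ t, R < |t| → h t = 0) ∧ (∀ t, R < |t| → deriv h t = 0) := by
  have hdiff : Differentiable ℝ h := hh.differentiable (by norm_num)
  have h1 : ContDiff ℝ 1 (deriv h) := (contDiff_succ_iff_deriv.1 (hh : ContDiff ℝ (1 + 1) h)).2.2
  have hdiff' : Differentiable ℝ (deriv h) := h1.differentiable (by norm_num)
  have hc : Continuous h := hh.continuous
  have hc' : Continuous (deriv h) := h1.continuous
  have hc'' : Continuous (deriv (deriv h)) := h1.continuous_deriv (le_refl _)
  have hsupp' : HasCompactSupport (deriv h) := hsupp.deriv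
  have hsupp'' : HasCompactSupport (deriv (deriv h)) := hsupp'.deriv
  obtain ⟨B, hB⟩ := hsupp.exists_bound_of_continuous hc
  obtain ⟨L, hL⟩ := hsupp'.exists_bound_of_continuous hc'
  obtain ⟨L₂, hL₂⟩ := hsupp''.exists_bound_of_continuous hc''
  have hB0 : 0 ≤ B := (norm_nonneg _).trans (hB 0)
  have hL0 : 0 ≤ L := (norm_nonneg _).trans (hL 0)
  have hL₂0 : 0 ≤ L₂ := (norm_nonneg _).trans (hL₂ 0)
  obtain ⟨R₀, hR₀⟩ := (hsupp.isCompact.isBounded.union hsupp'.isCompact.isBounded).subset_closedBall 0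
  set R : ℝ := max R₀ 0 with hR
  refine ⟨B, L, L₂, R, hB0, hL0, hL₂0, le_max_right _ _, fun t => ?_, fun t => ?_, fun a b => ?_,
    fun a b => ?_, fun t ht => ?_, fun t ht => ?_⟩
  · simpa [Real.norm_eq_abs] using hB t
  · simpa [Real.norm_eq_abs] using hL t
  · have := Convex.norm_image_sub_le_of_norm_deriv_le (f := h) (s := univ) (fun x _ => hdiff x)
      (fun x _ => hL x) convex_univ (mem_univ b) (mem_univ a)
    simpa [Real.norm_eq_abs] using this
  · have := Convex.norm_image_sub_le_of_norm_deriv_le (f := deriv h) (s := univ) (fun x _ => hdiff' x)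
      (fun x _ => hL₂ x) convex_univ (mem_univ b) (mem_univ a)
    simpa [Real.norm_eq_abs] using this
  · have hnot : t ∉ tsupport h := by
      intro hmem
      have := hR₀ (Or.inl hmem)
      rw [mem_closedBall, dist_zero_right, Real.norm_eq_abs] at this
      linarith [le_max_left R₀ 0]
    exact image_eq_zero_of_notMem_tsupport hnot
  · have hnot : t ∉ tsupport (deriv h) := by
      intro hmem
      have := hR₀ (Or.inr hmem)
      rw [mem_closedBall, dist_zero_right, Real.norm_eq_abs] at this
      linarith [le_max_left R₀ 0]
    exact image_eq_zero_of_notMem_tsupport hnot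

/-- The complement of `(-1, 1)` is `{u | 1 ≤ |u|}`. [folklore] -/
theorem compl_Ioo_neg_one_one : (Ioo (-1 : ℝ) 1)ᶜ = {u : ℝ | 1 ≤ |u|} := by
  ext u
  simp only [mem_compl_iff, mem_Ioo, not_and_or, not_lt, mem_setOf_eq, le_abs, le_neg]
  tauto

/-- `{u | 1 ≤ |u|}` is measurable. [folklore] -/
theorem measurableSet_one_le_abs : MeasurableSet {u : ℝ | 1 ≤ |u|} :=
  measurableSet_le measurable_const continuous_abs.measurable

/-- The odd kernel `u/(u² + y²)` integrates to zero over `(-1, 1)`. [folklore] -/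
theorem setIntegral_Ioo_odd_kernel {y : ℝ} (hy : 0 < y) :
    ∫ u in Ioo (-1 : ℝ) 1, u / (u ^ 2 + y ^ 2) = 0 := by
  rw [← integral_Ioc_eq_integral_Ioo, ← intervalIntegral.integral_of_le (by norm_num : (-1 : ℝ) ≤ 1)]
  have hderiv : ∀ u ∈ uIcc (-1 : ℝ) 1,
      HasDerivAt (fun u : ℝ => (1 / 2) * Real.log (u ^ 2 + y ^ 2)) (u / (u ^ 2 + y ^ 2)) u := by
    intro u _
    have hD : u ^ 2 + y ^ 2 ≠ 0 := by positivity
    have h1 : HasDerivAt (fun u : ℝ => u ^ 2 + y ^ 2) (2 * u) u := by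
      simpa using ((hasDerivAt_pow 2 u).add_const (y ^ 2))
    have h2 := (h1.log hD).const_mul (1 / 2)
    refine h2.congr_deriv ?_
    field_simp
  have hint : IntervalIntegrable (fun u : ℝ => u / (u ^ 2 + y ^ 2)) volume (-1) 1 :=
    (Continuous.div continuous_id (by fun_prop) fun u => by positivity).intervalIntegrable _ _
  rw [intervalIntegral.integral_eq_sub_of_hasDerivAt hderiv hint]
  norm_num

/-- Integrability of the pieces of the modified Hilbert transform of a `C²` compactly supported
function. [folklore] -/
theorem integrable_hilbert_pieces (hh : ContDiff ℝ 2 h) (hsupp : HasCompactSupport h) (x : ℝ) :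
    IntegrableOn (fun u => (h (x - u) - h x) / u) (Ioo (-1 : ℝ) 1) ∧
      IntegrableOn (fun u => h (x - u) / u) {u : ℝ | 1 ≤ |u|} ∧
      Integrable (fun t => h t * (t / (1 + t ^ 2))) := by
  obtain ⟨B, L, L₂, R, hB0, hL0, -, hR0, hB, -, hLip, -, hsuppR, -⟩ := exists_bounds_of_contDiff_two hh hsupp
  have hc : Continuous h := hh.continuous
  refine ⟨?_, ?_, ?_⟩
  · -- near piece: bounded by `L` on a set of finite measure
    have hmeas : AEStronglyMeasurable (fun u => (h (x - u) - h x) / u) volume :=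
      (((hc.comp (continuous_sub_left x)).sub continuous_const).measurable.div measurable_id).aestronglyMeasurable
    refine Measure.integrableOn_of_bounded (M := L) (measure_Ioo_lt_top.ne) hmeas ?_
    refine (ae_restrict_iff' measurableSet_Ioo).2 (ae_of_all _ fun u _ => ?_)
    rw [Real.norm_eq_abs]
    by_cases hu : u = 0
    · simp [hu, hL0]
    · rw [abs_div, div_le_iff₀ (abs_pos.2 hu)]
      have := hLip (x - u) x
      rwa [show x - u - x = -u by ring, abs_neg] at this
  · -- far piece: supported in `closedBall x R`, bounded by `B`
    have hzero : ∀ u, u ∉ closedBall x R → h (x - u) / u = 0 := by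
      intro u hu
      rw [mem_closedBall, Real.dist_eq] at hu
      push Not at hu
      rw [hsuppR (x - u) (by rwa [abs_sub_comm]), zero_div]
    have hint : IntegrableOn (fun u => h (x - u) / u) (closedBall x R ∩ {u : ℝ | 1 ≤ |u|}) := by
      refine Measure.integrableOn_of_bounded (M := B) ?_ ?_ ?_
      · exact (measure_mono inter_subset_left).trans_lt (measure_closedBall_lt_top) |>.ne
      · exact ((hc.comp (continuous_sub_left x)).measurable.div measurable_id).aestronglyMeasurable
      · refine (ae_restrict_iff' (measurableSet_closedBall.inter measurableSet_one_le_abs)).2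
          (ae_of_all _ fun u hu => ?_)
        have hu1 : 1 ≤ |u| := hu.2
        rw [Real.norm_eq_abs, abs_div]
        calc |h (x - u)| / |u| ≤ |h (x - u)| / 1 := by
              exact div_le_div_of_nonneg_left (abs_nonneg _) one_pos hu1
          _ ≤ B := by rw [div_one]; exact hB _
    -- extend by zero
    have hsplit : {u : ℝ | 1 ≤ |u|} = (closedBall x R ∩ {u : ℝ | 1 ≤ |u|}) ∪ ((closedBall x R)ᶜ ∩ {u : ℝ | 1 ≤ |u|}) := by
      rw [← union_inter_distrib_right, union_compl_self, univ_inter]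
    rw [hsplit]
    refine hint.union ?_
    refine (integrableOn_zero).congr_fun (fun u hu => (hzero u hu.1).symm) ?_
    exact (measurableSet_closedBall.compl).inter measurableSet_one_le_abs
  · -- the `t/(1+t²)` piece: continuous with compact support
    refine Continuous.integrable_of_hasCompactSupport (hc.mul ?_) (hsupp.mul_right)
    exact Continuous.div continuous_id (by fun_prop) fun t => by positivity

/-- **Boundary values of the conjugate Poisson integral of a `C²` compactly supported function**:
`Q_y[h](x) → ℋh(x)` as `y ↓ 0`, where
`ℋh(x) = π⁻¹ (∫_{(-1,1)} (h(x-u)-h(x))/u du + ∫_{|u|≥1} h(x-u)/u du + ∫ h(t) t/(1+t²) dt)`, with the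
explicit rate `|Q_y[h](x) - ℋh(x)| ≤ L y + π⁻¹ 2B y²`. [folklore] -/
theorem abs_conjPoissonIntegral_sub_hilbert_le (hh : ContDiff ℝ 2 h) (hsupp : HasCompactSupport h)
    (x : ℝ) : ∃ C : ℝ, 0 ≤ C ∧ ∀ y : ℝ, 0 < y → y ≤ 1 →
      |π⁻¹ * (∫ t : ℝ, h t * ((x - t) / ((x - t) ^ 2 + y ^ 2) + t / (1 + t ^ 2))) -
        π⁻¹ * ((∫ u in Ioo (-1 : ℝ) 1, (h (x - u) - h x) / u) + (∫ u in {u : ℝ | 1 ≤ |u|}, h (x - u) / u) +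
          ∫ t : ℝ, h t * (t / (1 + t ^ 2)))| ≤ C * y := by
  obtain ⟨B, L, L₂, R, hB0, hL0, -, hR0, hB, -, hLip, -, hsuppR, -⟩ := exists_bounds_of_contDiff_two hh hsupp
  obtain ⟨hnearI, hfarI, hCI⟩ := integrable_hilbert_pieces hh hsupp x
  have hc : Continuous h := hh.continuous
  have hm : AEStronglyMeasurable h volume := hc.aestronglyMeasurable
  refine ⟨L + π⁻¹ * (2 * B), by positivity, fun y hy hy1 => ?_⟩
  -- Step 1: split off the `t/(1+t²)` term and substitute `t = x - u`
  have hK1 : Integrable (fun t => h t * ((x - t) / ((x - t) ^ 2 + y ^ 2))) := by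
    refine Continuous.integrable_of_hasCompactSupport (hc.mul ?_) hsupp.mul_right
    exact Continuous.div (by fun_prop) (by fun_prop) fun t => by positivity
  have hsplit1 : ∫ t : ℝ, h t * ((x - t) / ((x - t) ^ 2 + y ^ 2) + t / (1 + t ^ 2)) =
      (∫ u : ℝ, h (x - u) * (u / (u ^ 2 + y ^ 2))) + ∫ t : ℝ, h t * (t / (1 + t ^ 2)) := by
    have h1 : ∫ t : ℝ, h t * ((x - t) / ((x - t) ^ 2 + y ^ 2) + t / (1 + t ^ 2)) =
        (∫ t : ℝ, h t * ((x - t) / ((x - t) ^ 2 + y ^ 2))) + ∫ t : ℝ, h t * (t / (1 + t ^ 2)) := by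
      rw [← integral_add hK1 hCI]
      exact integral_congr_ae (ae_of_all _ fun t => by ring)
    rw [h1]
    congr 1
    rw [← integral_sub_left_eq_self (fun u => h (x - u) * (u / (u ^ 2 + y ^ 2))) volume x]
    exact integral_congr_ae (ae_of_all _ fun t => by simp only [sub_sub_cancel])
  -- Step 2: split the `u`-integral at `|u| = 1`
  have hK2 : Integrable (fun u => h (x - u) * (u / (u ^ 2 + y ^ 2))) := by
    have := hK1.comp_sub_left x
    refine this.congr (ae_of_all _ fun u => ?_)
    simp only [sub_sub_cancel]
  have hsplit2 : ∫ u : ℝ, h (x - u) * (u / (u ^ 2 + y ^ 2)) =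
      (∫ u in Ioo (-1 : ℝ) 1, h (x - u) * (u / (u ^ 2 + y ^ 2))) +
        ∫ u in {u : ℝ | 1 ≤ |u|}, h (x - u) * (u / (u ^ 2 + y ^ 2)) := by
    rw [← integral_add_compl measurableSet_Ioo hK2, compl_Ioo_neg_one_one]
  -- Step 3: in the near part subtract `h x ∫ u/(u²+y²) = 0`
  have hnearK : IntegrableOn (fun u => (h (x - u) - h x) * (u / (u ^ 2 + y ^ 2))) (Ioo (-1 : ℝ) 1) := by
    have hcont : Continuous fun u => (h (x - u) - h x) * (u / (u ^ 2 + y ^ 2)) :=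
      ((hc.comp (continuous_sub_left x)).sub continuous_const).mul
        (Continuous.div continuous_id (by fun_prop) fun u => by positivity)
    exact (hcont.integrableOn_Icc (a := -1) (b := 1)).mono_set Ioo_subset_Icc_self
  have hsplit3 : ∫ u in Ioo (-1 : ℝ) 1, h (x - u) * (u / (u ^ 2 + y ^ 2)) =
      ∫ u in Ioo (-1 : ℝ) 1, (h (x - u) - h x) * (u / (u ^ 2 + y ^ 2)) := by
    have h1 : ∫ u in Ioo (-1 : ℝ) 1, (h (x - u) - h x) * (u / (u ^ 2 + y ^ 2)) =
        (∫ u in Ioo (-1 : ℝ) 1, h (x - u) * (u / (u ^ 2 + y ^ 2))) -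
          ∫ u in Ioo (-1 : ℝ) 1, h x * (u / (u ^ 2 + y ^ 2)) := by
      rw [← integral_sub hK2.integrableOn]
      · exact integral_congr_ae (ae_of_all _ fun u => by ring)
      · have hcont : Continuous fun u : ℝ => h x * (u / (u ^ 2 + y ^ 2)) :=
          continuous_const.mul (Continuous.div continuous_id (by fun_prop) fun u => by positivity)
        exact (hcont.integrableOn_Icc (a := -1) (b := 1)).mono_set Ioo_subset_Icc_self
    rw [h1, integral_const_mul, setIntegral_Ioo_odd_kernel hy, mul_zero, sub_zero]
  -- Step 4: the two error terms
  have herr_near : |(∫ u in Ioo (-1 : ℝ) 1, (h (x - u) - h x) * (u / (u ^ 2 + y ^ 2))) -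
      ∫ u in Ioo (-1 : ℝ) 1, (h (x - u) - h x) / u| ≤ L * π * y := by
    rw [← integral_sub hnearK hnearI]
    have hP := Literature.Analysis.InverseSpectral.integrable_poissonKernel hy (0 : ℝ)
    calc |∫ u in Ioo (-1 : ℝ) 1, (h (x - u) - h x) * (u / (u ^ 2 + y ^ 2)) - (h (x - u) - h x) / u|
        ≤ ∫ u in Ioo (-1 : ℝ) 1, |(h (x - u) - h x) * (u / (u ^ 2 + y ^ 2)) - (h (x - u) - h x) / u| := by
          simpa only [Real.norm_eq_abs] using norm_integral_le_integral_norm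
            (fun u => (h (x - u) - h x) * (u / (u ^ 2 + y ^ 2)) - (h (x - u) - h x) / u)
      _ ≤ ∫ u in Ioo (-1 : ℝ) 1, L * y * (y / ((0 - u) ^ 2 + y ^ 2)) := by
          refine setIntegral_mono_on (hnearK.sub hnearI).norm ((hP.const_mul (L * y)).integrableOn)
            measurableSet_Ioo (fun u _ => ?_)
          by_cases hu : u = 0
          · subst hu; simp; positivity
          · have hD : 0 < u ^ 2 + y ^ 2 := by positivity
            have heq : (h (x - u) - h x) * (u / (u ^ 2 + y ^ 2)) - (h (x - u) - h x) / u =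
                (h (x - u) - h x) / u * (-(y ^ 2) / (u ^ 2 + y ^ 2)) := by
              field_simp
              ring
            rw [heq, abs_mul]
            have h1 : |(h (x - u) - h x) / u| ≤ L := by
              rw [abs_div, div_le_iff₀ (abs_pos.2 hu)]
              have := hLip (x - u) x
              rwa [show x - u - x = -u by ring, abs_neg] at this
            have h2 : |-(y ^ 2) / (u ^ 2 + y ^ 2)| = y * (y / ((0 - u) ^ 2 + y ^ 2)) := by
              rw [abs_div, abs_neg, abs_of_pos (by positivity : (0:ℝ) < y ^ 2), abs_of_pos hD]
              ring
            rw [h2]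
            calc _ ≤ L * (y * (y / ((0 - u) ^ 2 + y ^ 2))) := mul_le_mul_of_nonneg_right h1 (by positivity)
              _ = _ := by ring
      _ ≤ ∫ u, L * y * (y / ((0 - u) ^ 2 + y ^ 2)) :=
          setIntegral_le_integral (hP.const_mul _) (ae_of_all _ fun u => by positivity)
      _ = L * π * y := by
          rw [integral_const_mul, Literature.Analysis.InverseSpectral.integral_poissonKernel hy 0]; ring
  have hfarK : IntegrableOn (fun u => h (x - u) * (u / (u ^ 2 + y ^ 2))) {u : ℝ | 1 ≤ |u|} :=
    hK2.integrableOn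
  obtain ⟨htailI, htail⟩ := Literature.Analysis.InverseSpectral.integral_tail_div_sq one_pos (y ^ 2)
  have herr_far : |(∫ u in {u : ℝ | 1 ≤ |u|}, h (x - u) * (u / (u ^ 2 + y ^ 2))) -
      ∫ u in {u : ℝ | 1 ≤ |u|}, h (x - u) / u| ≤ 2 * B * y ^ 2 := by
    rw [← integral_sub hfarK hfarI]
    calc |∫ u in {u : ℝ | 1 ≤ |u|}, h (x - u) * (u / (u ^ 2 + y ^ 2)) - h (x - u) / u|
        ≤ ∫ u in {u : ℝ | 1 ≤ |u|}, |h (x - u) * (u / (u ^ 2 + y ^ 2)) - h (x - u) / u| := by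
          simpa only [Real.norm_eq_abs] using norm_integral_le_integral_norm
            (fun u => h (x - u) * (u / (u ^ 2 + y ^ 2)) - h (x - u) / u)
      _ ≤ ∫ u in {u : ℝ | 1 ≤ |u|}, B * (y ^ 2 / u ^ 2) := by
          refine setIntegral_mono_on (hfarK.sub hfarI).norm (htailI.const_mul B)
            measurableSet_one_le_abs (fun u hu => ?_)
          have hu1 : 1 ≤ |u| := hu
          have hu0 : u ≠ 0 := by intro h0; rw [h0, abs_zero] at hu1; linarith
          have hD : 0 < u ^ 2 + y ^ 2 := by positivity
          have heq : h (x - u) * (u / (u ^ 2 + y ^ 2)) - h (x - u) / u =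
              h (x - u) * (-(y ^ 2) / (u * (u ^ 2 + y ^ 2))) := by
            field_simp
            ring
          rw [heq, abs_mul]
          refine mul_le_mul (hB _) ?_ (abs_nonneg _) hB0
          rw [abs_div, abs_neg, abs_of_pos (by positivity : (0:ℝ) < y ^ 2), abs_mul, abs_of_pos hD]
          rw [div_le_div_iff₀ (by positivity) (by positivity)]
          have hu2 : u ^ 2 = |u| ^ 2 := (sq_abs u).symm
          have h3 : u ^ 2 ≤ |u| * (u ^ 2 + y ^ 2) := by
            rw [hu2]; nlinarith [sq_nonneg y, abs_nonneg u]
          exact mul_le_mul_of_nonneg_left h3 (by positivity)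
      _ = B * (2 * y ^ 2 / 1) := by rw [integral_const_mul, htail]
      _ = 2 * B * y ^ 2 := by ring
  -- Step 5: assemble
  rw [hsplit1, hsplit2, hsplit3, ← mul_sub]
  have hy2 : y ^ 2 ≤ y := by nlinarith
  rw [abs_mul, abs_of_pos (inv_pos.2 Real.pi_pos)]
  set a₁ := ∫ u in Ioo (-1 : ℝ) 1, (h (x - u) - h x) * (u / (u ^ 2 + y ^ 2))
  set a₂ := ∫ u in {u : ℝ | 1 ≤ |u|}, h (x - u) * (u / (u ^ 2 + y ^ 2))
  set b₁ := ∫ u in Ioo (-1 : ℝ) 1, (h (x - u) - h x) / u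
  set b₂ := ∫ u in {u : ℝ | 1 ≤ |u|}, h (x - u) / u
  set c := ∫ t : ℝ, h t * (t / (1 + t ^ 2))
  have : a₁ + a₂ + c - (b₁ + b₂ + c) = (a₁ - b₁) + (a₂ - b₂) := by ring
  rw [this]
  calc π⁻¹ * |a₁ - b₁ + (a₂ - b₂)| ≤ π⁻¹ * (|a₁ - b₁| + |a₂ - b₂|) :=
        mul_le_mul_of_nonneg_left (abs_add_le _ _) (by positivity)
    _ ≤ π⁻¹ * (L * π * y + 2 * B * y ^ 2) := by gcongr
    _ = L * y + π⁻¹ * (2 * B) * y ^ 2 := by field_simp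
    _ ≤ L * y + π⁻¹ * (2 * B) * y := by gcongr
    _ = (L + π⁻¹ * (2 * B)) * y := by ring

/-- **`Q_y[h](x) → ℋh(x)` as `y ↓ 0`** for `h ∈ C²` with compact support. [folklore] -/
theorem tendsto_conjPoissonIntegral (hh : ContDiff ℝ 2 h) (hsupp : HasCompactSupport h) (x : ℝ) :
    Tendsto (fun y : ℝ => π⁻¹ * ∫ t : ℝ, h t * ((x - t) / ((x - t) ^ 2 + y ^ 2) + t / (1 + t ^ 2)))
      (𝓝[>] 0)
      (𝓝 (π⁻¹ * ((∫ u in Ioo (-1 : ℝ) 1, (h (x - u) - h x) / u) +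
        (∫ u in {u : ℝ | 1 ≤ |u|}, h (x - u) / u) + ∫ t : ℝ, h t * (t / (1 + t ^ 2))))) := by
  obtain ⟨C, hC0, hC⟩ := abs_conjPoissonIntegral_sub_hilbert_le hh hsupp x
  rw [Metric.tendsto_nhdsWithin_nhds]
  intro ε hε
  refine ⟨min 1 (ε / (C + 1)), by positivity, fun {y} hy hyd => ?_⟩
  have hy0 : 0 < y := hy
  rw [Real.dist_eq, sub_zero, abs_of_pos hy0] at hyd
  have hy1 : y ≤ 1 := (hyd.trans_le (min_le_left _ _)).le
  have hyε : y < ε / (C + 1) := hyd.trans_le (min_le_right _ _)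
  rw [Real.dist_eq]
  calc _ ≤ C * y := hC y hy0 hy1
    _ ≤ (C + 1) * y := by nlinarith
    _ < (C + 1) * (ε / (C + 1)) := mul_lt_mul_of_pos_left hyε (by positivity)
    _ = ε := by field_simp

/-- The same limit along a sequence `y_n → 0⁺`. [folklore] -/
theorem tendsto_conjPoissonIntegral_seq (hh : ContDiff ℝ 2 h) (hsupp : HasCompactSupport h) (x : ℝ)
    {ys : ℕ → ℝ} (hpos : ∀ n, 0 < ys n) (hlim : Tendsto ys atTop (𝓝 0)) :
    Tendsto (fun n => π⁻¹ * ∫ t : ℝ, h t * ((x - t) / ((x - t) ^ 2 + (ys n) ^ 2) + t / (1 + t ^ 2)))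
      atTop
      (𝓝 (π⁻¹ * ((∫ u in Ioo (-1 : ℝ) 1, (h (x - u) - h x) / u) +
        (∫ u in {u : ℝ | 1 ≤ |u|}, h (x - u) / u) + ∫ t : ℝ, h t * (t / (1 + t ^ 2))))) := by
  have h1 := tendsto_conjPoissonIntegral hh hsupp x
  have h2 : Tendsto ys atTop (𝓝[>] 0) :=
    tendsto_nhdsWithin_iff.2 ⟨hlim, Eventually.of_forall fun n => hpos n⟩
  exact h1.comp h2

/-- **The modified Hilbert transform of a `C²` compactly supported function is differentiable**,
with `(ℋh)'(x) = π⁻¹ (∫_{(-1,1)} (h'(x-u)-h'(x))/u du + ∫_{|u|≥1} h'(x-u)/u du)` (differentiation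
under the integral sign). [folklore] -/
theorem hasDerivAt_hilbert (hh : ContDiff ℝ 2 h) (hsupp : HasCompactSupport h) (x₀ : ℝ) :
    HasDerivAt (fun x => π⁻¹ * ((∫ u in Ioo (-1 : ℝ) 1, (h (x - u) - h x) / u) +
        (∫ u in {u : ℝ | 1 ≤ |u|}, h (x - u) / u) + ∫ t : ℝ, h t * (t / (1 + t ^ 2))))
      (π⁻¹ * ((∫ u in Ioo (-1 : ℝ) 1, (deriv h (x₀ - u) - deriv h x₀) / u) +
        ∫ u in {u : ℝ | 1 ≤ |u|}, deriv h (x₀ - u) / u)) x₀ := by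
  obtain ⟨B, L, L₂, R, hB0, hL0, hL₂0, hR0, hB, hL, hLip, hLip', hsuppR, hsuppR'⟩ :=
    exists_bounds_of_contDiff_two hh hsupp
  have hc : Continuous h := hh.continuous
  have hdiff : Differentiable ℝ h := hh.differentiable (by norm_num)
  have h1 : ContDiff ℝ 1 (deriv h) := (contDiff_succ_iff_deriv.1 (hh : ContDiff ℝ (1 + 1) h)).2.2
  have hc' : Continuous (deriv h) := h1.continuous
  -- pointwise derivatives of the integrands
  have hder1 : ∀ u x : ℝ, HasDerivAt (fun x => (h (x - u) - h x) / u)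
      ((deriv h (x - u) - deriv h x) / u) x := by
    intro u x
    have ha : HasDerivAt (fun x => h (x - u)) (deriv h (x - u)) x := by
      simpa [Function.comp_def] using ((hdiff (x - u)).hasDerivAt).comp x ((hasDerivAt_id x).sub_const u)
    exact (ha.sub (hdiff x).hasDerivAt).div_const u
  have hder2 : ∀ u x : ℝ, HasDerivAt (fun x => h (x - u) / u) (deriv h (x - u) / u) x := by
    intro u x
    have ha : HasDerivAt (fun x => h (x - u)) (deriv h (x - u)) x := by
      simpa [Function.comp_def] using ((hdiff (x - u)).hasDerivAt).comp x ((hasDerivAt_id x).sub_const u)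
    exact ha.div_const u
  -- the near piece
  have hnear : HasDerivAt (fun x => ∫ u in Ioo (-1 : ℝ) 1, (h (x - u) - h x) / u)
      (∫ u in Ioo (-1 : ℝ) 1, (deriv h (x₀ - u) - deriv h x₀) / u) x₀ := by
    have hmeas : ∀ x, AEStronglyMeasurable (fun u => (h (x - u) - h x) / u)
        (volume.restrict (Ioo (-1 : ℝ) 1)) := fun x =>
      (((hc.comp (continuous_sub_left x)).sub continuous_const).measurable.div
        measurable_id).aestronglyMeasurable
    have key := hasDerivAt_integral_of_dominated_loc_of_deriv_le
      (μ := volume.restrict (Ioo (-1 : ℝ) 1)) (x₀ := x₀)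
      (F := fun x u => (h (x - u) - h x) / u) (F' := fun x u => (deriv h (x - u) - deriv h x) / u)
      (bound := fun _ => L₂) (ball_mem_nhds x₀ zero_lt_one) (Eventually.of_forall hmeas)
      (integrable_hilbert_pieces hh hsupp x₀).1 ?_ ?_ ?_ ?_
    · exact key.2
    · exact (((hc'.comp (continuous_sub_left x₀)).sub continuous_const).measurable.div
        measurable_id).aestronglyMeasurable
    · refine Eventually.of_forall fun u x _ => ?_
      rw [Real.norm_eq_abs]
      by_cases hu : u = 0
      · simp [hu, hL₂0]
      · rw [abs_div, div_le_iff₀ (abs_pos.2 hu)]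
        have := hLip' (x - u) x
        rwa [show x - u - x = -u by ring, abs_neg] at this
    · exact (integrableOn_const (measure_Ioo_lt_top.ne) : IntegrableOn (fun _ : ℝ => L₂) (Ioo (-1 : ℝ) 1))
    · exact Eventually.of_forall fun u x _ => hder1 u x
  -- the far piece
  have hfar : HasDerivAt (fun x => ∫ u in {u : ℝ | 1 ≤ |u|}, h (x - u) / u)
      (∫ u in {u : ℝ | 1 ≤ |u|}, deriv h (x₀ - u) / u) x₀ := by
    have hmeas : ∀ x, AEStronglyMeasurable (fun u => h (x - u) / u)
        (volume.restrict {u : ℝ | 1 ≤ |u|}) := fun x =>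
      ((hc.comp (continuous_sub_left x)).measurable.div measurable_id).aestronglyMeasurable
    set bound : ℝ → ℝ := (closedBall x₀ (R + 1)).indicator fun _ => L with hbound
    have key := hasDerivAt_integral_of_dominated_loc_of_deriv_le
      (μ := volume.restrict {u : ℝ | 1 ≤ |u|}) (x₀ := x₀)
      (F := fun x u => h (x - u) / u) (F' := fun x u => deriv h (x - u) / u)
      (bound := bound) (ball_mem_nhds x₀ zero_lt_one) (Eventually.of_forall hmeas)
      (integrable_hilbert_pieces hh hsupp x₀).2.1 ?_ ?_ ?_ ?_
    · exact key.2
    · exact ((hc'.comp (continuous_sub_left x₀)).measurable.div measurable_id).aestronglyMeasurable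
    · refine (ae_restrict_iff' measurableSet_one_le_abs).2 (ae_of_all _ fun u hu x hx => ?_)
      have hu1 : 1 ≤ |u| := hu
      rw [Real.norm_eq_abs, abs_div, hbound]
      by_cases hmem : u ∈ closedBall x₀ (R + 1)
      · rw [indicator_of_mem hmem]
        calc |deriv h (x - u)| / |u| ≤ |deriv h (x - u)| / 1 :=
              div_le_div_of_nonneg_left (abs_nonneg _) one_pos hu1
          _ ≤ L := by rw [div_one]; exact hL _
      · rw [indicator_of_notMem hmem]
        rw [mem_closedBall, Real.dist_eq, not_le] at hmem
        rw [mem_ball, Real.dist_eq] at hx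
        have hxu : R < |x - u| := by
          have := abs_sub_abs_le_abs_sub (u - x₀) (x - x₀)
          rw [show u - x₀ - (x - x₀) = u - x by ring, abs_sub_comm u x] at this
          linarith
        rw [hsuppR' (x - u) hxu, abs_zero, zero_div]
    · have h1 : Integrable bound volume := by
        rw [hbound, integrable_indicator_iff measurableSet_closedBall]
        exact integrableOn_const (measure_closedBall_lt_top.ne)
      exact h1.mono_measure Measure.restrict_le_self
    · exact Eventually.of_forall fun u x _ => hder2 u x
  -- assemble
  have := ((hnear.add hfar).add_const (∫ t : ℝ, h t * (t / (1 + t ^ 2)))).const_mul π⁻¹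
  exact this

end Hilbert

end Literature.Analysis.Fourier
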